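import Literature.MathematicalPhysics.QuantumFieldTheory.Balaban1983to89.Node00.WilsonActionSecondVariationNearFlat

/-!
# NODE 00 — THE SECOND VARIATION OF THE WILSON ACTION (5), VII: ONE-SIDED AT PLAQUETTE-SMALL BACKGROUNDS (GAUGE-INVARIANT), PER CONTOUR AND PER PLAQUETTE —
# `−Re Tr((σ² + Σ_{k<l}[X′_k,X′_l])·U(∂p))∕N ≥ Re Tr(σ⋆σ)∕N − ‖U(∂p) − 1‖·s_p(X)² ≥ −‖U(∂p) − 1‖·s_p(X)²`, `σ = ΣX′_k` the covariant curl in the bond frames, `s_p = Σ_{k≤4}‖X_{b_k}‖`: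
# PLAQUETTE smallness `‖U(∂p) − 1‖ = dist1 U(∂p)` only — no bond-wise near-flatness, no gauge fixing (the lattice sums are in the sequel `…PlaqSmallLattice`)

Cell `pub-ymgap`, WIDTH SEAT `pub-ymgap-dag-n12-w4` generation 5 (HUMAN RULING D-0149 ∕ director-ym №197; DAG node N12 = [B15]; key K1⁹ `stmt-QuantumFields-27364`,
`--kind proof --supports …`, count-neutral; INBOX CLAIM-1 l.39446).  The lane owner's word (dag-n12-c g19, LOCATED-GEOM v3 memo `HOME/pub-ymgap-dag-n12-c/N12-GEOM-V3-MEMO.md` §2 (W2),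
2026-08-28): «Wilson side, FAR part (plaquettes of Ω₁(Z) off the window, in the support of DX_f): only a ONE-SIDED bound is needed … At a plaquette with U₀(∂p) ε-near 1 the second variation of
−Re Tr U(∂p) along Y is ≥ −C·ε·Σ_{b∈∂p}|Y b|² — a GAUGE-INVARIANT statement (at U₀(∂p) = 1 exactly it is the square of the covariant curl ≥ 0).  So the far part needs PLAQUETTE smallness of U₀ …
NOT bondwise flatness ⇒ C1 can shrink to C1_window.  NEW estimate to type: `secondVariation_reTr_plaq_ge_neg_of_plaqSmall`».  This file types it, with the constant `C = 1` in the tree's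
normalisation (`Re Tr∕N`, operator norm (19)), and keeps the non-negative covariant term.  SEQUEL of dag-n12-w2's `Node00.WilsonActionSecondVariation` (p583639: ★★★
`hasDerivAt_deriv_wilsonAction4_expChart` = `−(1∕N)Σ_p Re Tr([(ΣX′)² + Σ_{k<l}[X′_k,X′_l]]·U(∂p))`), `…Expansion` (p585069: `secondVariation_expChart_of_plaqHol_eq_one`, `star_letters_eq_neg`,
`star_sum_of_skew`, `star_commSum_of_skew`, `re_trace_eq_zero_of_star_eq_neg`, `re_trace_mul_self_of_star_eq_neg`, `size_letters_eq`, `sq_add_commSum_mul_eq_inserted`), `…NearFlat` (p587195: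
`norm_inserted_sub_flat_le`, the BOND-WISE two-sided letter this file complements), pub-balaban's `Beta.TransportVertices` (`two_smul_quad`, `norm_quad_le`) and
`MatrixNorms.abs_nReTr_le_opNorm` (B7 (20)) — all CONSUMED BY NAME (the sequel adds `…L2Letters`' incidence count `sum_plaq_boundary_sq_le`, p593907).

PRINT.  [B9] = [Balaban1985BackgroundPropagators] p. 391 (3.6)–(3.7): «A^η(U′U₀) = A^η(U₀) + ⟨D^η_{U₀}A, η⁻²Im ∂U₀⟩ + ½⟨A, Δ^η(U₀)A⟩ + ⋯», the bracket of the quadratic term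
«tr((D^η_{U₀}A)(p))² Re U₀(∂p) + tr Σ_{b₁≺b₂} i[A′(b₁),A′(b₂)] η⁻²Im U₀(∂p)»; p. 392 (3.10): «⟨A, ΔA⟩ = ⟨A, D*DA⟩ + ⟨A, Δ′A⟩ … with our assumptions on the configuration U the operator Δ′ will
be a bounded, small operator», the assumption being (3.8) p. 391 «|U(∂p) − 1| < ε» — a condition on PLAQUETTE variables.  [B16] = [Balaban1989LargeFieldII] p. 357: «The leading term in the
expansion is the quadratic form with the background field identically equal to 1»; (1.7) p. 358 (one-sided use).  [B15] = [Balaban1989LargeFieldI] (8) p. 279 ∕ [15] Thm 1: the small-plaquette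
class of the background.  READING (declared): the `D*D`-part of (3.10) at the background `U` is `(1∕N)Σ_p Re Tr(σ_p⋆σ_p)`, `σ_p = X′₁+X′₂+X′₃+X′₄` the transported letters of the prequels
(`= η·(D^η_U X)(p)` by (3.4), nothing about `D^η` asserted); `Δ′`'s form is `−(1∕N)Σ_p Re Tr([σ_p² + Σ_{k<l}[X′_k,X′_l]]·(U(∂p) − 1))`, bounded here by `Σ_p ‖U(∂p)−1‖·s_p²` — print's «small
operator» made quantitative in the letters of this chain, with `|U(∂p) − 1|` and NOT `|U_b − 1|` as the smallness parameter.

CONTENTS (theorems only; no `def`, no `instance`, no `sorry`).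
* §1 PER CONTOUR (any list `l` of skew-Hermitian matrices — any contour length —, any matrix `W`): `re_trace_sum_mul_sum_add_commSum_mul_eq` (the split
  `Re Tr((S²+C)W) = −Re Tr(S⋆S) + Re Tr((S²+C)(W−1))`, `S = Σl`, `C = commSum l`: `Re Tr S² = −Re Tr S⋆S`, `Re Tr C = 0`), `norm_sum_mul_sum_add_commSum_le_size_sq` (`‖S²+C‖ = ‖2·quad l‖ ≤ (size l)²`),
  `matrix_re_trace_star_mul_self_nonneg`, ★ `abs_neg_nReTr_secondOrder_mul_sub_covariant_le` (`|−Re Tr((S²+C)W)∕N − Re Tr(S⋆S)∕N| ≤ (size l)²·‖W − 1‖`), ★ `covariant_sub_le_neg_nReTr_secondOrder_mul`,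
  `neg_le_neg_nReTr_secondOrder_mul` (one-sided forms).
* §2 PER PLAQUETTE in the letters of the prequels (`A, B, C ∈ SU(N)` the first three bond variables, `X₁, …, X₄ ∈ 𝔰𝔲(N)`, any `W` with `‖W − 1‖ ≤ e`): `covariantPlaq_sub_le`, `abs_plaq_sub_covariantPlaq_le`,
  `neg_le_plaq` — `size = ‖X₁‖+‖X₂‖+‖X₃‖+‖X₄‖` by `size_letters_eq`; and the BOND-WISE flat comparison per plaquette `flatPlaq_sub_le` (w2's `norm_inserted_sub_flat_le` read back through
  `sq_add_commSum_mul_eq_inserted`: `‖σ⁰_p‖²∕N − 4δ·s_p² ≤ q_p(U)`, `σ⁰_p` the plain lattice curl).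
* SEQUEL (`Node00.WilsonActionSecondVariationPlaqSmallLattice`, this seat, file 2): the same summed over the torus against `hasDerivAt_deriv_wilsonAction4_expChart` —
  `(1∕N)Σ_p Re Tr(σ_p⋆σ_p) − Σ_p ε_p·s_p² ≤ Q_U(X)` for any plaquette budget `‖↑U(∂p) − 1‖ ≤ ε_p`, the memo's `−Σ_p ε_p·s_p² ≤ Q_U(X)`, the `ℓ²(bonds)`∕`PlaqSmallOn` editions
  `−8(d−1)ε·Σ_b‖X_b‖² ≤ Q_U(X)`, and the WINDOW SPLIT `(1∕N)Σ_{p∈W}‖σ⁰_p‖² − 4Σ_{p∈W}δ_p s_p² − Σ_{p∉W}ε_p s_p² ≤ Q_U(X)` («C1_window + P1»).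

HONEST FRAMING: an elementary operator-norm ∕ trace inequality about the tree's own action functional; by itself it removes NOTHING displayed on the N12 road — it is the
letter that lets the Wilson-side bond-wise near-flatness hypothesis (C1 of the (χ)∕J-C chain) shrink to the window, the far plaquettes needing only `dist1 U(∂p) ≤ ε` (the lane owner's junction,
option (b)); ring-shaped `Ω₁(Z)` still need the chart-side (X2) work of the memo; nothing of Bałaban's ((1.7), [15] Thm 1 (8), Prop. 1) is asserted; count-neutral; N12 NOT discharged; K1⁹ NOT
closed; counts unmoved (5∕27 · 28∕28); one finite 𝕋⁴ programme at fixed ε, Bałaban AS PRINTED with locators; R4 closes the conditional rung `BalabanLadder.UV` only — the Yang–Mills mass gap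
(Clay) is NOT proved by any of this; nothing continuum ∕ ℝ⁴ ∕ OS.
-/

noncomputable section

namespace Literature.MathematicalPhysics.QuantumFieldTheory.Balaban1983to89.Node00

open T4AdjointCovarianceUnitary (lieSU)
open Beta.TransportVertices (commSum size quad two_smul_quad norm_quad_le size_nonneg)
open scoped Matrix.Norms.L2Operator

/-! ## §1  Per contour: the split `−Re Tr((S²+C)W) = Re Tr(S⋆S) − Re Tr((S²+C)(W−1))` and the bound `‖S²+C‖ ≤ (Σ_k‖a_k‖)²` -/

section Contour

variable {N : ℕ}

/-- **THE SPLIT IDENTITY** (any contour): for skew-Hermitian letters `a_k` with `S = Σa_k`, `C = Σ_{k<l}[a_k,a_l]` and ANY matrix `W`,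
`Re Tr((S²+C)·W) = −Re Tr(S⋆S) + Re Tr((S²+C)·(W − 1))` — `Re Tr S² = −Re Tr S⋆S` (`S⋆ = −S`) and `Re Tr C = 0` (`C⋆ = −C`): the `D*D`-part and the `Δ′`-part of [B9] (3.10) at one plaquette.
[cite: Balaban1985BackgroundPropagators, (3.10) p.392, (3.6)–(3.7) p.391] -/
theorem re_trace_sum_mul_sum_add_commSum_mul_eq (l : List (Matrix (Fin N) (Fin N) ℂ)) (h : ∀ a ∈ l, star a = -a) (W : Matrix (Fin N) (Fin N) ℂ) :
    (Matrix.trace ((l.sum * l.sum + commSum l) * W)).re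
      = -(Matrix.trace (star l.sum * l.sum)).re + (Matrix.trace ((l.sum * l.sum + commSum l) * (W - 1))).re := by
  have hW : (l.sum * l.sum + commSum l) * W = (l.sum * l.sum + commSum l) + (l.sum * l.sum + commSum l) * (W - 1) := by
    rw [mul_sub, mul_one, add_sub_cancel]
  rw [hW, Matrix.trace_add, Complex.add_re, Matrix.trace_add, Complex.add_re, re_trace_mul_self_of_star_eq_neg (star_sum_of_skew l h),
    re_trace_eq_zero_of_star_eq_neg (star_commSum_of_skew l h), add_zero]

/-- **THE SECOND-ORDER MATRIX IS BOUNDED BY THE SQUARED SIZE**: `‖S² + C‖ = ‖2·quad l‖ ≤ (size l)²` (pub-balaban's `two_smul_quad`, `norm_quad_le`), `size l = Σ_k‖a_k‖`.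
[cite: Balaban1985BackgroundPropagators, (3.6) p.391; Balaban1985Averaging, (20) p.21] -/
theorem norm_sum_mul_sum_add_commSum_le_size_sq (l : List (Matrix (Fin N) (Fin N) ℂ)) : ‖l.sum * l.sum + commSum l‖ ≤ size l ^ 2 := by
  rw [← two_smul_quad ℝ l, norm_smul, Real.norm_two]
  have h := norm_quad_le ℝ l
  linarith

/-- `0 ≤ Re Tr(S⋆S)` (`= Σ_{ij}|S_{ij}|²`, `MatrixNorms.sum_norm_sq_eq_re_trace`). [cite: Balaban1985Averaging, (17)–(18) p.21 (bookkeeping)] -/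
theorem matrix_re_trace_star_mul_self_nonneg (S : Matrix (Fin N) (Fin N) ℂ) : 0 ≤ (Matrix.trace (star S * S)).re := by
  rw [Matrix.star_eq_conjTranspose, ← MatrixNorms.sum_norm_sq_eq_re_trace]
  positivity

/-- ★ **PER CONTOUR, TWO-SIDED**: for skew-Hermitian letters and ANY `W`, `|−Re Tr((S²+C)W)∕N − Re Tr(S⋆S)∕N| ≤ (size l)²·‖W − 1‖` — the `Δ′`-part of (3.10) is small with the PLAQUETTE
deviation `‖W − 1‖` (B7 (20) `|Re Tr M|∕N ≤ ‖M‖`, `‖(S²+C)(W−1)‖ ≤ (size l)²‖W−1‖`). [cite: Balaban1985BackgroundPropagators, (3.8) p.391, (3.10) p.392; Balaban1985Averaging, (20) p.21] -/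
theorem abs_neg_nReTr_secondOrder_mul_sub_covariant_le (l : List (Matrix (Fin N) (Fin N) ℂ)) (h : ∀ a ∈ l, star a = -a) (W : Matrix (Fin N) (Fin N) ℂ) :
    |-(Matrix.trace ((l.sum * l.sum + commSum l) * W)).re / (Fintype.card (Fin N) : ℝ) - (Matrix.trace (star l.sum * l.sum)).re / (Fintype.card (Fin N) : ℝ)|
      ≤ size l ^ 2 * ‖W - 1‖ := by
  rw [re_trace_sum_mul_sum_add_commSum_mul_eq l h W]
  have h1 : -(-(Matrix.trace (star l.sum * l.sum)).re + (Matrix.trace ((l.sum * l.sum + commSum l) * (W - 1))).re) / (Fintype.card (Fin N) : ℝ)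
        - (Matrix.trace (star l.sum * l.sum)).re / (Fintype.card (Fin N) : ℝ)
      = -((Matrix.trace ((l.sum * l.sum + commSum l) * (W - 1))).re / (Fintype.card (Fin N) : ℝ)) := by ring
  rw [h1, abs_neg]
  have h2 := MatrixNorms.abs_nReTr_le_opNorm ((l.sum * l.sum + commSum l) * (W - 1))
  unfold UnitaryModel.nReTr at h2
  exact h2.trans ((norm_mul_le _ _).trans (mul_le_mul_of_nonneg_right (norm_sum_mul_sum_add_commSum_le_size_sq l) (norm_nonneg _)))

/-- ★ **PER CONTOUR, ONE-SIDED**: `Re Tr(S⋆S)∕N − (size l)²·‖W − 1‖ ≤ −Re Tr((S²+C)W)∕N`. [cite: Balaban1985BackgroundPropagators, (3.10) p.392; Balaban1989LargeFieldII, (1.7) p.358] -/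
theorem covariant_sub_le_neg_nReTr_secondOrder_mul (l : List (Matrix (Fin N) (Fin N) ℂ)) (h : ∀ a ∈ l, star a = -a) (W : Matrix (Fin N) (Fin N) ℂ) :
    (Matrix.trace (star l.sum * l.sum)).re / (Fintype.card (Fin N) : ℝ) - size l ^ 2 * ‖W - 1‖
      ≤ -(Matrix.trace ((l.sum * l.sum + commSum l) * W)).re / (Fintype.card (Fin N) : ℝ) := by
  have h1 := (abs_le.mp (abs_neg_nReTr_secondOrder_mul_sub_covariant_le l h W)).1
  linarith

/-- **PER CONTOUR, THE MEMO'S SHAPE**: `−(size l)²·‖W − 1‖ ≤ −Re Tr((S²+C)W)∕N` (the covariant term is non-negative). [cite: Balaban1985BackgroundPropagators, (3.10) p.392; Balaban1989LargeFieldII, (1.7) p.358] -/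
theorem neg_le_neg_nReTr_secondOrder_mul (l : List (Matrix (Fin N) (Fin N) ℂ)) (h : ∀ a ∈ l, star a = -a) (W : Matrix (Fin N) (Fin N) ℂ) :
    -(size l ^ 2 * ‖W - 1‖) ≤ -(Matrix.trace ((l.sum * l.sum + commSum l) * W)).re / (Fintype.card (Fin N) : ℝ) := by
  have h1 := covariant_sub_le_neg_nReTr_secondOrder_mul l h W
  have h2 : 0 ≤ (Matrix.trace (star l.sum * l.sum)).re / (Fintype.card (Fin N) : ℝ) := div_nonneg (matrix_re_trace_star_mul_self_nonneg _) (Nat.cast_nonneg _)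
  linarith

end Contour

/-! ## §2  Per plaquette, in the letters of the prequels (`A, B, C` the first three bond variables; the fourth enters only through the plaquette variable `W`) -/

section Plaquette

variable {N : ℕ}

/-- ★ **PER PLAQUETTE, ONE-SIDED, PLAQUETTE SMALLNESS ONLY**: for `A, B, C ∈ SU(N)`, `X₁, …, X₄ ∈ 𝔰𝔲(N)`, the transported letters `X′₁ = AX₁A⋆, X′₂ = (AB)X₂(AB)⋆, X′₃ = −(AB)X₃(AB)⋆,
X′₄ = −(ABC⋆)X₄(ABC⋆)⋆`, `σ = ΣX′_k`, and ANY matrix `W` with `‖W − 1‖ ≤ e`:  `Re Tr(σ⋆σ)∕N − e·(‖X₁‖+‖X₂‖+‖X₃‖+‖X₄‖)² ≤ −Re Tr((σ² + Σ_{k<l}[X′_k,X′_l])·W)∕N`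
(§1 with `size = Σ‖X_k‖`, `size_letters_eq`: transports cost nothing). [cite: Balaban1985BackgroundPropagators, (3.8) p.391, (3.10) p.392; Balaban1989LargeFieldII, (1.7) p.358] -/
theorem covariantPlaq_sub_le (A B C : SU N) (X₁ X₂ X₃ X₄ : lieSU (Fin N)) (W : Matrix (Fin N) (Fin N) ℂ) {e : ℝ} (hW : ‖W - 1‖ ≤ e) :
    (Matrix.trace (star ((A : Matrix (Fin N) (Fin N) ℂ) * (X₁ : Matrix (Fin N) (Fin N) ℂ) * star (A : Matrix (Fin N) (Fin N) ℂ)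
            + (A : Matrix (Fin N) (Fin N) ℂ) * (B : Matrix (Fin N) (Fin N) ℂ) * (X₂ : Matrix (Fin N) (Fin N) ℂ) * star ((A : Matrix (Fin N) (Fin N) ℂ) * (B : Matrix (Fin N) (Fin N) ℂ))
            + -((A : Matrix (Fin N) (Fin N) ℂ) * (B : Matrix (Fin N) (Fin N) ℂ) * (X₃ : Matrix (Fin N) (Fin N) ℂ) * star ((A : Matrix (Fin N) (Fin N) ℂ) * (B : Matrix (Fin N) (Fin N) ℂ)))
            + -((A : Matrix (Fin N) (Fin N) ℂ) * (B : Matrix (Fin N) (Fin N) ℂ) * star (C : Matrix (Fin N) (Fin N) ℂ) * (X₄ : Matrix (Fin N) (Fin N) ℂ) * star ((A : Matrix (Fin N) (Fin N) ℂ) * (B : Matrix (Fin N) (Fin N) ℂ) * star (C : Matrix (Fin N) (Fin N) ℂ))))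
          * ((A : Matrix (Fin N) (Fin N) ℂ) * (X₁ : Matrix (Fin N) (Fin N) ℂ) * star (A : Matrix (Fin N) (Fin N) ℂ)
            + (A : Matrix (Fin N) (Fin N) ℂ) * (B : Matrix (Fin N) (Fin N) ℂ) * (X₂ : Matrix (Fin N) (Fin N) ℂ) * star ((A : Matrix (Fin N) (Fin N) ℂ) * (B : Matrix (Fin N) (Fin N) ℂ))
            + -((A : Matrix (Fin N) (Fin N) ℂ) * (B : Matrix (Fin N) (Fin N) ℂ) * (X₃ : Matrix (Fin N) (Fin N) ℂ) * star ((A : Matrix (Fin N) (Fin N) ℂ) * (B : Matrix (Fin N) (Fin N) ℂ)))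
            + -((A : Matrix (Fin N) (Fin N) ℂ) * (B : Matrix (Fin N) (Fin N) ℂ) * star (C : Matrix (Fin N) (Fin N) ℂ) * (X₄ : Matrix (Fin N) (Fin N) ℂ) * star ((A : Matrix (Fin N) (Fin N) ℂ) * (B : Matrix (Fin N) (Fin N) ℂ) * star (C : Matrix (Fin N) (Fin N) ℂ)))))).re / (Fintype.card (Fin N) : ℝ)
        - e * (‖(X₁ : Matrix (Fin N) (Fin N) ℂ)‖ + ‖(X₂ : Matrix (Fin N) (Fin N) ℂ)‖ + ‖(X₃ : Matrix (Fin N) (Fin N) ℂ)‖ + ‖(X₄ : Matrix (Fin N) (Fin N) ℂ)‖) ^ 2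
      ≤ -(Matrix.trace ((((A : Matrix (Fin N) (Fin N) ℂ) * (X₁ : Matrix (Fin N) (Fin N) ℂ) * star (A : Matrix (Fin N) (Fin N) ℂ)
            + (A : Matrix (Fin N) (Fin N) ℂ) * (B : Matrix (Fin N) (Fin N) ℂ) * (X₂ : Matrix (Fin N) (Fin N) ℂ) * star ((A : Matrix (Fin N) (Fin N) ℂ) * (B : Matrix (Fin N) (Fin N) ℂ))
            + -((A : Matrix (Fin N) (Fin N) ℂ) * (B : Matrix (Fin N) (Fin N) ℂ) * (X₃ : Matrix (Fin N) (Fin N) ℂ) * star ((A : Matrix (Fin N) (Fin N) ℂ) * (B : Matrix (Fin N) (Fin N) ℂ)))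
            + -((A : Matrix (Fin N) (Fin N) ℂ) * (B : Matrix (Fin N) (Fin N) ℂ) * star (C : Matrix (Fin N) (Fin N) ℂ) * (X₄ : Matrix (Fin N) (Fin N) ℂ) * star ((A : Matrix (Fin N) (Fin N) ℂ) * (B : Matrix (Fin N) (Fin N) ℂ) * star (C : Matrix (Fin N) (Fin N) ℂ))))
          * ((A : Matrix (Fin N) (Fin N) ℂ) * (X₁ : Matrix (Fin N) (Fin N) ℂ) * star (A : Matrix (Fin N) (Fin N) ℂ)
            + (A : Matrix (Fin N) (Fin N) ℂ) * (B : Matrix (Fin N) (Fin N) ℂ) * (X₂ : Matrix (Fin N) (Fin N) ℂ) * star ((A : Matrix (Fin N) (Fin N) ℂ) * (B : Matrix (Fin N) (Fin N) ℂ))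
            + -((A : Matrix (Fin N) (Fin N) ℂ) * (B : Matrix (Fin N) (Fin N) ℂ) * (X₃ : Matrix (Fin N) (Fin N) ℂ) * star ((A : Matrix (Fin N) (Fin N) ℂ) * (B : Matrix (Fin N) (Fin N) ℂ)))
            + -((A : Matrix (Fin N) (Fin N) ℂ) * (B : Matrix (Fin N) (Fin N) ℂ) * star (C : Matrix (Fin N) (Fin N) ℂ) * (X₄ : Matrix (Fin N) (Fin N) ℂ) * star ((A : Matrix (Fin N) (Fin N) ℂ) * (B : Matrix (Fin N) (Fin N) ℂ) * star (C : Matrix (Fin N) (Fin N) ℂ))))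
          + commSum [ (A : Matrix (Fin N) (Fin N) ℂ) * (X₁ : Matrix (Fin N) (Fin N) ℂ) * star (A : Matrix (Fin N) (Fin N) ℂ),
            (A : Matrix (Fin N) (Fin N) ℂ) * (B : Matrix (Fin N) (Fin N) ℂ) * (X₂ : Matrix (Fin N) (Fin N) ℂ) * star ((A : Matrix (Fin N) (Fin N) ℂ) * (B : Matrix (Fin N) (Fin N) ℂ)),
            -((A : Matrix (Fin N) (Fin N) ℂ) * (B : Matrix (Fin N) (Fin N) ℂ) * (X₃ : Matrix (Fin N) (Fin N) ℂ) * star ((A : Matrix (Fin N) (Fin N) ℂ) * (B : Matrix (Fin N) (Fin N) ℂ))),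
            -((A : Matrix (Fin N) (Fin N) ℂ) * (B : Matrix (Fin N) (Fin N) ℂ) * star (C : Matrix (Fin N) (Fin N) ℂ) * (X₄ : Matrix (Fin N) (Fin N) ℂ) * star ((A : Matrix (Fin N) (Fin N) ℂ) * (B : Matrix (Fin N) (Fin N) ℂ) * star (C : Matrix (Fin N) (Fin N) ℂ))) ])
          * W)).re / (Fintype.card (Fin N) : ℝ) := by
  have hsk := star_letters_eq_neg A B C X₁ X₂ X₃ X₄
  have h := covariant_sub_le_neg_nReTr_secondOrder_mul _ hsk W
  rw [size_letters_eq] at h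
  simp only [List.sum_cons, List.sum_nil, add_zero, ← add_assoc] at h
  have hs : 0 ≤ (‖(X₁ : Matrix (Fin N) (Fin N) ℂ)‖ + ‖(X₂ : Matrix (Fin N) (Fin N) ℂ)‖ + ‖(X₃ : Matrix (Fin N) (Fin N) ℂ)‖ + ‖(X₄ : Matrix (Fin N) (Fin N) ℂ)‖) ^ 2 := sq_nonneg _
  nlinarith [mul_le_mul_of_nonneg_left hW hs]

/-- ★ **PER PLAQUETTE, TWO-SIDED**: `|−Re Tr((σ² + Σ[X′_k,X′_l])·W)∕N − Re Tr(σ⋆σ)∕N| ≤ e·(‖X₁‖+‖X₂‖+‖X₃‖+‖X₄‖)²` when `‖W − 1‖ ≤ e`.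
[cite: Balaban1985BackgroundPropagators, (3.8) p.391, (3.10) p.392] -/
theorem abs_plaq_sub_covariantPlaq_le (A B C : SU N) (X₁ X₂ X₃ X₄ : lieSU (Fin N)) (W : Matrix (Fin N) (Fin N) ℂ) {e : ℝ} (hW : ‖W - 1‖ ≤ e) :
    |-(Matrix.trace ((((A : Matrix (Fin N) (Fin N) ℂ) * (X₁ : Matrix (Fin N) (Fin N) ℂ) * star (A : Matrix (Fin N) (Fin N) ℂ)
            + (A : Matrix (Fin N) (Fin N) ℂ) * (B : Matrix (Fin N) (Fin N) ℂ) * (X₂ : Matrix (Fin N) (Fin N) ℂ) * star ((A : Matrix (Fin N) (Fin N) ℂ) * (B : Matrix (Fin N) (Fin N) ℂ))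
            + -((A : Matrix (Fin N) (Fin N) ℂ) * (B : Matrix (Fin N) (Fin N) ℂ) * (X₃ : Matrix (Fin N) (Fin N) ℂ) * star ((A : Matrix (Fin N) (Fin N) ℂ) * (B : Matrix (Fin N) (Fin N) ℂ)))
            + -((A : Matrix (Fin N) (Fin N) ℂ) * (B : Matrix (Fin N) (Fin N) ℂ) * star (C : Matrix (Fin N) (Fin N) ℂ) * (X₄ : Matrix (Fin N) (Fin N) ℂ) * star ((A : Matrix (Fin N) (Fin N) ℂ) * (B : Matrix (Fin N) (Fin N) ℂ) * star (C : Matrix (Fin N) (Fin N) ℂ))))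
          * ((A : Matrix (Fin N) (Fin N) ℂ) * (X₁ : Matrix (Fin N) (Fin N) ℂ) * star (A : Matrix (Fin N) (Fin N) ℂ)
            + (A : Matrix (Fin N) (Fin N) ℂ) * (B : Matrix (Fin N) (Fin N) ℂ) * (X₂ : Matrix (Fin N) (Fin N) ℂ) * star ((A : Matrix (Fin N) (Fin N) ℂ) * (B : Matrix (Fin N) (Fin N) ℂ))
            + -((A : Matrix (Fin N) (Fin N) ℂ) * (B : Matrix (Fin N) (Fin N) ℂ) * (X₃ : Matrix (Fin N) (Fin N) ℂ) * star ((A : Matrix (Fin N) (Fin N) ℂ) * (B : Matrix (Fin N) (Fin N) ℂ)))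
            + -((A : Matrix (Fin N) (Fin N) ℂ) * (B : Matrix (Fin N) (Fin N) ℂ) * star (C : Matrix (Fin N) (Fin N) ℂ) * (X₄ : Matrix (Fin N) (Fin N) ℂ) * star ((A : Matrix (Fin N) (Fin N) ℂ) * (B : Matrix (Fin N) (Fin N) ℂ) * star (C : Matrix (Fin N) (Fin N) ℂ))))
          + commSum [ (A : Matrix (Fin N) (Fin N) ℂ) * (X₁ : Matrix (Fin N) (Fin N) ℂ) * star (A : Matrix (Fin N) (Fin N) ℂ),
            (A : Matrix (Fin N) (Fin N) ℂ) * (B : Matrix (Fin N) (Fin N) ℂ) * (X₂ : Matrix (Fin N) (Fin N) ℂ) * star ((A : Matrix (Fin N) (Fin N) ℂ) * (B : Matrix (Fin N) (Fin N) ℂ)),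
            -((A : Matrix (Fin N) (Fin N) ℂ) * (B : Matrix (Fin N) (Fin N) ℂ) * (X₃ : Matrix (Fin N) (Fin N) ℂ) * star ((A : Matrix (Fin N) (Fin N) ℂ) * (B : Matrix (Fin N) (Fin N) ℂ))),
            -((A : Matrix (Fin N) (Fin N) ℂ) * (B : Matrix (Fin N) (Fin N) ℂ) * star (C : Matrix (Fin N) (Fin N) ℂ) * (X₄ : Matrix (Fin N) (Fin N) ℂ) * star ((A : Matrix (Fin N) (Fin N) ℂ) * (B : Matrix (Fin N) (Fin N) ℂ) * star (C : Matrix (Fin N) (Fin N) ℂ))) ])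
          * W)).re / (Fintype.card (Fin N) : ℝ)
        - (Matrix.trace (star ((A : Matrix (Fin N) (Fin N) ℂ) * (X₁ : Matrix (Fin N) (Fin N) ℂ) * star (A : Matrix (Fin N) (Fin N) ℂ)
            + (A : Matrix (Fin N) (Fin N) ℂ) * (B : Matrix (Fin N) (Fin N) ℂ) * (X₂ : Matrix (Fin N) (Fin N) ℂ) * star ((A : Matrix (Fin N) (Fin N) ℂ) * (B : Matrix (Fin N) (Fin N) ℂ))
            + -((A : Matrix (Fin N) (Fin N) ℂ) * (B : Matrix (Fin N) (Fin N) ℂ) * (X₃ : Matrix (Fin N) (Fin N) ℂ) * star ((A : Matrix (Fin N) (Fin N) ℂ) * (B : Matrix (Fin N) (Fin N) ℂ)))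
            + -((A : Matrix (Fin N) (Fin N) ℂ) * (B : Matrix (Fin N) (Fin N) ℂ) * star (C : Matrix (Fin N) (Fin N) ℂ) * (X₄ : Matrix (Fin N) (Fin N) ℂ) * star ((A : Matrix (Fin N) (Fin N) ℂ) * (B : Matrix (Fin N) (Fin N) ℂ) * star (C : Matrix (Fin N) (Fin N) ℂ))))
          * ((A : Matrix (Fin N) (Fin N) ℂ) * (X₁ : Matrix (Fin N) (Fin N) ℂ) * star (A : Matrix (Fin N) (Fin N) ℂ)
            + (A : Matrix (Fin N) (Fin N) ℂ) * (B : Matrix (Fin N) (Fin N) ℂ) * (X₂ : Matrix (Fin N) (Fin N) ℂ) * star ((A : Matrix (Fin N) (Fin N) ℂ) * (B : Matrix (Fin N) (Fin N) ℂ))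
            + -((A : Matrix (Fin N) (Fin N) ℂ) * (B : Matrix (Fin N) (Fin N) ℂ) * (X₃ : Matrix (Fin N) (Fin N) ℂ) * star ((A : Matrix (Fin N) (Fin N) ℂ) * (B : Matrix (Fin N) (Fin N) ℂ)))
            + -((A : Matrix (Fin N) (Fin N) ℂ) * (B : Matrix (Fin N) (Fin N) ℂ) * star (C : Matrix (Fin N) (Fin N) ℂ) * (X₄ : Matrix (Fin N) (Fin N) ℂ) * star ((A : Matrix (Fin N) (Fin N) ℂ) * (B : Matrix (Fin N) (Fin N) ℂ) * star (C : Matrix (Fin N) (Fin N) ℂ)))))).re / (Fintype.card (Fin N) : ℝ)|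
      ≤ e * (‖(X₁ : Matrix (Fin N) (Fin N) ℂ)‖ + ‖(X₂ : Matrix (Fin N) (Fin N) ℂ)‖ + ‖(X₃ : Matrix (Fin N) (Fin N) ℂ)‖ + ‖(X₄ : Matrix (Fin N) (Fin N) ℂ)‖) ^ 2 := by
  have hsk := star_letters_eq_neg A B C X₁ X₂ X₃ X₄
  have h := abs_neg_nReTr_secondOrder_mul_sub_covariant_le _ hsk W
  rw [size_letters_eq] at h
  simp only [List.sum_cons, List.sum_nil, add_zero, ← add_assoc] at h
  refine h.trans ?_
  rw [mul_comm]
  exact mul_le_mul_of_nonneg_right hW (sq_nonneg _)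

/-- **PER PLAQUETTE, THE MEMO'S SHAPE**: `−e·(‖X₁‖+‖X₂‖+‖X₃‖+‖X₄‖)² ≤ −Re Tr((σ² + Σ[X′_k,X′_l])·W)∕N` when `‖W − 1‖ ≤ e`.
[cite: Balaban1985BackgroundPropagators, (3.10) p.392; Balaban1989LargeFieldII, (1.7) p.358] -/
theorem neg_le_plaq (A B C : SU N) (X₁ X₂ X₃ X₄ : lieSU (Fin N)) (W : Matrix (Fin N) (Fin N) ℂ) {e : ℝ} (hW : ‖W - 1‖ ≤ e) :
    -(e * (‖(X₁ : Matrix (Fin N) (Fin N) ℂ)‖ + ‖(X₂ : Matrix (Fin N) (Fin N) ℂ)‖ + ‖(X₃ : Matrix (Fin N) (Fin N) ℂ)‖ + ‖(X₄ : Matrix (Fin N) (Fin N) ℂ)‖) ^ 2)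
      ≤ -(Matrix.trace ((((A : Matrix (Fin N) (Fin N) ℂ) * (X₁ : Matrix (Fin N) (Fin N) ℂ) * star (A : Matrix (Fin N) (Fin N) ℂ)
            + (A : Matrix (Fin N) (Fin N) ℂ) * (B : Matrix (Fin N) (Fin N) ℂ) * (X₂ : Matrix (Fin N) (Fin N) ℂ) * star ((A : Matrix (Fin N) (Fin N) ℂ) * (B : Matrix (Fin N) (Fin N) ℂ))
            + -((A : Matrix (Fin N) (Fin N) ℂ) * (B : Matrix (Fin N) (Fin N) ℂ) * (X₃ : Matrix (Fin N) (Fin N) ℂ) * star ((A : Matrix (Fin N) (Fin N) ℂ) * (B : Matrix (Fin N) (Fin N) ℂ)))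
            + -((A : Matrix (Fin N) (Fin N) ℂ) * (B : Matrix (Fin N) (Fin N) ℂ) * star (C : Matrix (Fin N) (Fin N) ℂ) * (X₄ : Matrix (Fin N) (Fin N) ℂ) * star ((A : Matrix (Fin N) (Fin N) ℂ) * (B : Matrix (Fin N) (Fin N) ℂ) * star (C : Matrix (Fin N) (Fin N) ℂ))))
          * ((A : Matrix (Fin N) (Fin N) ℂ) * (X₁ : Matrix (Fin N) (Fin N) ℂ) * star (A : Matrix (Fin N) (Fin N) ℂ)
            + (A : Matrix (Fin N) (Fin N) ℂ) * (B : Matrix (Fin N) (Fin N) ℂ) * (X₂ : Matrix (Fin N) (Fin N) ℂ) * star ((A : Matrix (Fin N) (Fin N) ℂ) * (B : Matrix (Fin N) (Fin N) ℂ))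
            + -((A : Matrix (Fin N) (Fin N) ℂ) * (B : Matrix (Fin N) (Fin N) ℂ) * (X₃ : Matrix (Fin N) (Fin N) ℂ) * star ((A : Matrix (Fin N) (Fin N) ℂ) * (B : Matrix (Fin N) (Fin N) ℂ)))
            + -((A : Matrix (Fin N) (Fin N) ℂ) * (B : Matrix (Fin N) (Fin N) ℂ) * star (C : Matrix (Fin N) (Fin N) ℂ) * (X₄ : Matrix (Fin N) (Fin N) ℂ) * star ((A : Matrix (Fin N) (Fin N) ℂ) * (B : Matrix (Fin N) (Fin N) ℂ) * star (C : Matrix (Fin N) (Fin N) ℂ))))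
          + commSum [ (A : Matrix (Fin N) (Fin N) ℂ) * (X₁ : Matrix (Fin N) (Fin N) ℂ) * star (A : Matrix (Fin N) (Fin N) ℂ),
            (A : Matrix (Fin N) (Fin N) ℂ) * (B : Matrix (Fin N) (Fin N) ℂ) * (X₂ : Matrix (Fin N) (Fin N) ℂ) * star ((A : Matrix (Fin N) (Fin N) ℂ) * (B : Matrix (Fin N) (Fin N) ℂ)),
            -((A : Matrix (Fin N) (Fin N) ℂ) * (B : Matrix (Fin N) (Fin N) ℂ) * (X₃ : Matrix (Fin N) (Fin N) ℂ) * star ((A : Matrix (Fin N) (Fin N) ℂ) * (B : Matrix (Fin N) (Fin N) ℂ))),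
            -((A : Matrix (Fin N) (Fin N) ℂ) * (B : Matrix (Fin N) (Fin N) ℂ) * star (C : Matrix (Fin N) (Fin N) ℂ) * (X₄ : Matrix (Fin N) (Fin N) ℂ) * star ((A : Matrix (Fin N) (Fin N) ℂ) * (B : Matrix (Fin N) (Fin N) ℂ) * star (C : Matrix (Fin N) (Fin N) ℂ))) ])
          * W)).re / (Fintype.card (Fin N) : ℝ) := by
  have h := covariantPlaq_sub_le A B C X₁ X₂ X₃ X₄ W hW
  have h2 : 0 ≤ (Matrix.trace (star ((A : Matrix (Fin N) (Fin N) ℂ) * (X₁ : Matrix (Fin N) (Fin N) ℂ) * star (A : Matrix (Fin N) (Fin N) ℂ)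
            + (A : Matrix (Fin N) (Fin N) ℂ) * (B : Matrix (Fin N) (Fin N) ℂ) * (X₂ : Matrix (Fin N) (Fin N) ℂ) * star ((A : Matrix (Fin N) (Fin N) ℂ) * (B : Matrix (Fin N) (Fin N) ℂ))
            + -((A : Matrix (Fin N) (Fin N) ℂ) * (B : Matrix (Fin N) (Fin N) ℂ) * (X₃ : Matrix (Fin N) (Fin N) ℂ) * star ((A : Matrix (Fin N) (Fin N) ℂ) * (B : Matrix (Fin N) (Fin N) ℂ)))
            + -((A : Matrix (Fin N) (Fin N) ℂ) * (B : Matrix (Fin N) (Fin N) ℂ) * star (C : Matrix (Fin N) (Fin N) ℂ) * (X₄ : Matrix (Fin N) (Fin N) ℂ) * star ((A : Matrix (Fin N) (Fin N) ℂ) * (B : Matrix (Fin N) (Fin N) ℂ) * star (C : Matrix (Fin N) (Fin N) ℂ))))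
          * ((A : Matrix (Fin N) (Fin N) ℂ) * (X₁ : Matrix (Fin N) (Fin N) ℂ) * star (A : Matrix (Fin N) (Fin N) ℂ)
            + (A : Matrix (Fin N) (Fin N) ℂ) * (B : Matrix (Fin N) (Fin N) ℂ) * (X₂ : Matrix (Fin N) (Fin N) ℂ) * star ((A : Matrix (Fin N) (Fin N) ℂ) * (B : Matrix (Fin N) (Fin N) ℂ))
            + -((A : Matrix (Fin N) (Fin N) ℂ) * (B : Matrix (Fin N) (Fin N) ℂ) * (X₃ : Matrix (Fin N) (Fin N) ℂ) * star ((A : Matrix (Fin N) (Fin N) ℂ) * (B : Matrix (Fin N) (Fin N) ℂ)))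
            + -((A : Matrix (Fin N) (Fin N) ℂ) * (B : Matrix (Fin N) (Fin N) ℂ) * star (C : Matrix (Fin N) (Fin N) ℂ) * (X₄ : Matrix (Fin N) (Fin N) ℂ) * star ((A : Matrix (Fin N) (Fin N) ℂ) * (B : Matrix (Fin N) (Fin N) ℂ) * star (C : Matrix (Fin N) (Fin N) ℂ)))))).re / (Fintype.card (Fin N) : ℝ) :=
    div_nonneg (matrix_re_trace_star_mul_self_nonneg _) (Nat.cast_nonneg _)
  linarith


/-- ★ **PER PLAQUETTE, THE BOND-WISE FLAT COMPARISON, ONE-SIDED** (dag-n12-w2's `norm_inserted_sub_flat_le` read back through `sq_add_commSum_mul_eq_inserted` and B7 (20)): if the four bond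
variables satisfy `‖A−1‖, ‖B−1‖, ‖C−1‖, ‖D−1‖ ≤ δ`, then `‖X₁ + X₂ − X₃ − X₄‖²∕N − 4δ·(‖X₁‖+‖X₂‖+‖X₃‖+‖X₄‖)² ≤ −Re Tr((σ² + Σ[X′_k,X′_l])·(ABC⋆D⋆))∕N` — the flat value is the Hilbert–Schmidt
square (17) of the plain lattice curl (`norm_sq_lieSU_eq_re_trace`; the flat commutator term is traceless). [cite: Balaban1989LargeFieldII, p.357, (1.7) p.358; Balaban1985BackgroundPropagators, (3.10) p.392] -/
theorem flatPlaq_sub_le (A B C D : SU N) (X₁ X₂ X₃ X₄ : lieSU (Fin N)) {δ : ℝ}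
    (hA : ‖(A : Matrix (Fin N) (Fin N) ℂ) - 1‖ ≤ δ) (hB : ‖(B : Matrix (Fin N) (Fin N) ℂ) - 1‖ ≤ δ) (hC : ‖(C : Matrix (Fin N) (Fin N) ℂ) - 1‖ ≤ δ) (hD : ‖(D : Matrix (Fin N) (Fin N) ℂ) - 1‖ ≤ δ) :
    ‖X₁ + X₂ - X₃ - X₄‖ ^ 2 / (Fintype.card (Fin N) : ℝ) - 4 * δ * (‖(X₁ : Matrix (Fin N) (Fin N) ℂ)‖ + ‖(X₂ : Matrix (Fin N) (Fin N) ℂ)‖ + ‖(X₃ : Matrix (Fin N) (Fin N) ℂ)‖ + ‖(X₄ : Matrix (Fin N) (Fin N) ℂ)‖) ^ 2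
      ≤ -(Matrix.trace ((((A : Matrix (Fin N) (Fin N) ℂ) * (X₁ : Matrix (Fin N) (Fin N) ℂ) * star (A : Matrix (Fin N) (Fin N) ℂ)
            + (A : Matrix (Fin N) (Fin N) ℂ) * (B : Matrix (Fin N) (Fin N) ℂ) * (X₂ : Matrix (Fin N) (Fin N) ℂ) * star ((A : Matrix (Fin N) (Fin N) ℂ) * (B : Matrix (Fin N) (Fin N) ℂ))
            + -((A : Matrix (Fin N) (Fin N) ℂ) * (B : Matrix (Fin N) (Fin N) ℂ) * (X₃ : Matrix (Fin N) (Fin N) ℂ) * star ((A : Matrix (Fin N) (Fin N) ℂ) * (B : Matrix (Fin N) (Fin N) ℂ)))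
            + -((A : Matrix (Fin N) (Fin N) ℂ) * (B : Matrix (Fin N) (Fin N) ℂ) * star (C : Matrix (Fin N) (Fin N) ℂ) * (X₄ : Matrix (Fin N) (Fin N) ℂ) * star ((A : Matrix (Fin N) (Fin N) ℂ) * (B : Matrix (Fin N) (Fin N) ℂ) * star (C : Matrix (Fin N) (Fin N) ℂ))))
          * ((A : Matrix (Fin N) (Fin N) ℂ) * (X₁ : Matrix (Fin N) (Fin N) ℂ) * star (A : Matrix (Fin N) (Fin N) ℂ)
            + (A : Matrix (Fin N) (Fin N) ℂ) * (B : Matrix (Fin N) (Fin N) ℂ) * (X₂ : Matrix (Fin N) (Fin N) ℂ) * star ((A : Matrix (Fin N) (Fin N) ℂ) * (B : Matrix (Fin N) (Fin N) ℂ))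
            + -((A : Matrix (Fin N) (Fin N) ℂ) * (B : Matrix (Fin N) (Fin N) ℂ) * (X₃ : Matrix (Fin N) (Fin N) ℂ) * star ((A : Matrix (Fin N) (Fin N) ℂ) * (B : Matrix (Fin N) (Fin N) ℂ)))
            + -((A : Matrix (Fin N) (Fin N) ℂ) * (B : Matrix (Fin N) (Fin N) ℂ) * star (C : Matrix (Fin N) (Fin N) ℂ) * (X₄ : Matrix (Fin N) (Fin N) ℂ) * star ((A : Matrix (Fin N) (Fin N) ℂ) * (B : Matrix (Fin N) (Fin N) ℂ) * star (C : Matrix (Fin N) (Fin N) ℂ))))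
          + commSum [ (A : Matrix (Fin N) (Fin N) ℂ) * (X₁ : Matrix (Fin N) (Fin N) ℂ) * star (A : Matrix (Fin N) (Fin N) ℂ),
            (A : Matrix (Fin N) (Fin N) ℂ) * (B : Matrix (Fin N) (Fin N) ℂ) * (X₂ : Matrix (Fin N) (Fin N) ℂ) * star ((A : Matrix (Fin N) (Fin N) ℂ) * (B : Matrix (Fin N) (Fin N) ℂ)),
            -((A : Matrix (Fin N) (Fin N) ℂ) * (B : Matrix (Fin N) (Fin N) ℂ) * (X₃ : Matrix (Fin N) (Fin N) ℂ) * star ((A : Matrix (Fin N) (Fin N) ℂ) * (B : Matrix (Fin N) (Fin N) ℂ))),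
            -((A : Matrix (Fin N) (Fin N) ℂ) * (B : Matrix (Fin N) (Fin N) ℂ) * star (C : Matrix (Fin N) (Fin N) ℂ) * (X₄ : Matrix (Fin N) (Fin N) ℂ) * star ((A : Matrix (Fin N) (Fin N) ℂ) * (B : Matrix (Fin N) (Fin N) ℂ) * star (C : Matrix (Fin N) (Fin N) ℂ))) ])
          * ((A : Matrix (Fin N) (Fin N) ℂ) * (B : Matrix (Fin N) (Fin N) ℂ) * star (C : Matrix (Fin N) (Fin N) ℂ) * star (D : Matrix (Fin N) (Fin N) ℂ)))).re / (Fintype.card (Fin N) : ℝ) := by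
  rw [sq_add_commSum_mul_eq_inserted]
  have hdev := norm_inserted_sub_flat_le A B C D X₁ X₂ X₃ X₄ hA hB hC hD
  -- the flat value `Re Tr F = −‖X₁ + X₂ − X₃ − X₄‖²`
  have hins := sq_add_commSum_mul_eq_inserted (1 : SU N) 1 1 1 X₁ X₂ X₃ X₄
  have hsk := star_letters_eq_neg (1 : SU N) 1 1 X₁ X₂ X₃ X₄
  have h0 := re_trace_sum_mul_sum_add_commSum_mul_eq _ hsk 1
  have h1c : ((1 : SU N) : Matrix (Fin N) (Fin N) ℂ) = 1 := rfl
  simp only [h1c, one_mul, mul_one, star_one, sub_self, mul_zero, Matrix.trace_zero, Complex.zero_re, add_zero, List.sum_cons, List.sum_nil,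
    ← add_assoc] at hins h0
  rw [hins] at h0
  have hσ : ‖X₁ + X₂ - X₃ - X₄‖ ^ 2 = (Matrix.trace (star ((X₁ : Matrix (Fin N) (Fin N) ℂ) + (X₂ : Matrix (Fin N) (Fin N) ℂ) + -(X₃ : Matrix (Fin N) (Fin N) ℂ) + -(X₄ : Matrix (Fin N) (Fin N) ℂ))
      * ((X₁ : Matrix (Fin N) (Fin N) ℂ) + (X₂ : Matrix (Fin N) (Fin N) ℂ) + -(X₃ : Matrix (Fin N) (Fin N) ℂ) + -(X₄ : Matrix (Fin N) (Fin N) ℂ)))).re := by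
    rw [norm_sq_lieSU_eq_re_trace, Submodule.coe_sub, Submodule.coe_sub, Submodule.coe_add]
    simp only [sub_eq_add_neg]
  have hF : (Matrix.trace ((X₁ : Matrix (Fin N) (Fin N) ℂ) * (X₁ : Matrix (Fin N) (Fin N) ℂ) + (X₂ : Matrix (Fin N) (Fin N) ℂ) * (X₂ : Matrix (Fin N) (Fin N) ℂ)
            + (X₃ : Matrix (Fin N) (Fin N) ℂ) * (X₃ : Matrix (Fin N) (Fin N) ℂ) + (X₄ : Matrix (Fin N) (Fin N) ℂ) * (X₄ : Matrix (Fin N) (Fin N) ℂ)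
          + 2 • ((X₁ : Matrix (Fin N) (Fin N) ℂ) * (X₂ : Matrix (Fin N) (Fin N) ℂ) - (X₁ : Matrix (Fin N) (Fin N) ℂ) * (X₃ : Matrix (Fin N) (Fin N) ℂ)
            - (X₁ : Matrix (Fin N) (Fin N) ℂ) * (X₄ : Matrix (Fin N) (Fin N) ℂ) - (X₂ : Matrix (Fin N) (Fin N) ℂ) * (X₃ : Matrix (Fin N) (Fin N) ℂ)
            - (X₂ : Matrix (Fin N) (Fin N) ℂ) * (X₄ : Matrix (Fin N) (Fin N) ℂ) + (X₃ : Matrix (Fin N) (Fin N) ℂ) * (X₄ : Matrix (Fin N) (Fin N) ℂ)))).re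
      = -‖X₁ + X₂ - X₃ - X₄‖ ^ 2 := by
    rw [hσ]; linarith [h0]
  have htr := MatrixNorms.abs_nReTr_le_opNorm
    (((A : Matrix (Fin N) (Fin N) ℂ) * ((X₁ : Matrix (Fin N) (Fin N) ℂ) * (X₁ : Matrix (Fin N) (Fin N) ℂ)) * (B : Matrix (Fin N) (Fin N) ℂ) * star (C : Matrix (Fin N) (Fin N) ℂ) * star (D : Matrix (Fin N) (Fin N) ℂ)
      + (A : Matrix (Fin N) (Fin N) ℂ) * (B : Matrix (Fin N) (Fin N) ℂ) * ((X₂ : Matrix (Fin N) (Fin N) ℂ) * (X₂ : Matrix (Fin N) (Fin N) ℂ)) * star (C : Matrix (Fin N) (Fin N) ℂ) * star (D : Matrix (Fin N) (Fin N) ℂ)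
      + (A : Matrix (Fin N) (Fin N) ℂ) * (B : Matrix (Fin N) (Fin N) ℂ) * ((X₃ : Matrix (Fin N) (Fin N) ℂ) * (X₃ : Matrix (Fin N) (Fin N) ℂ)) * star (C : Matrix (Fin N) (Fin N) ℂ) * star (D : Matrix (Fin N) (Fin N) ℂ)
      + (A : Matrix (Fin N) (Fin N) ℂ) * (B : Matrix (Fin N) (Fin N) ℂ) * star (C : Matrix (Fin N) (Fin N) ℂ) * ((X₄ : Matrix (Fin N) (Fin N) ℂ) * (X₄ : Matrix (Fin N) (Fin N) ℂ)) * star (D : Matrix (Fin N) (Fin N) ℂ)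
      + 2 • ((A : Matrix (Fin N) (Fin N) ℂ) * (X₁ : Matrix (Fin N) (Fin N) ℂ) * (B : Matrix (Fin N) (Fin N) ℂ) * (X₂ : Matrix (Fin N) (Fin N) ℂ) * star (C : Matrix (Fin N) (Fin N) ℂ) * star (D : Matrix (Fin N) (Fin N) ℂ)
          - (A : Matrix (Fin N) (Fin N) ℂ) * (X₁ : Matrix (Fin N) (Fin N) ℂ) * (B : Matrix (Fin N) (Fin N) ℂ) * (X₃ : Matrix (Fin N) (Fin N) ℂ) * star (C : Matrix (Fin N) (Fin N) ℂ) * star (D : Matrix (Fin N) (Fin N) ℂ)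
          - (A : Matrix (Fin N) (Fin N) ℂ) * (X₁ : Matrix (Fin N) (Fin N) ℂ) * (B : Matrix (Fin N) (Fin N) ℂ) * star (C : Matrix (Fin N) (Fin N) ℂ) * (X₄ : Matrix (Fin N) (Fin N) ℂ) * star (D : Matrix (Fin N) (Fin N) ℂ)
          - (A : Matrix (Fin N) (Fin N) ℂ) * (B : Matrix (Fin N) (Fin N) ℂ) * (X₂ : Matrix (Fin N) (Fin N) ℂ) * (X₃ : Matrix (Fin N) (Fin N) ℂ) * star (C : Matrix (Fin N) (Fin N) ℂ) * star (D : Matrix (Fin N) (Fin N) ℂ)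
          - (A : Matrix (Fin N) (Fin N) ℂ) * (B : Matrix (Fin N) (Fin N) ℂ) * (X₂ : Matrix (Fin N) (Fin N) ℂ) * star (C : Matrix (Fin N) (Fin N) ℂ) * (X₄ : Matrix (Fin N) (Fin N) ℂ) * star (D : Matrix (Fin N) (Fin N) ℂ)
          + (A : Matrix (Fin N) (Fin N) ℂ) * (B : Matrix (Fin N) (Fin N) ℂ) * (X₃ : Matrix (Fin N) (Fin N) ℂ) * star (C : Matrix (Fin N) (Fin N) ℂ) * (X₄ : Matrix (Fin N) (Fin N) ℂ) * star (D : Matrix (Fin N) (Fin N) ℂ)))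
      - ((X₁ : Matrix (Fin N) (Fin N) ℂ) * (X₁ : Matrix (Fin N) (Fin N) ℂ) + (X₂ : Matrix (Fin N) (Fin N) ℂ) * (X₂ : Matrix (Fin N) (Fin N) ℂ)
            + (X₃ : Matrix (Fin N) (Fin N) ℂ) * (X₃ : Matrix (Fin N) (Fin N) ℂ) + (X₄ : Matrix (Fin N) (Fin N) ℂ) * (X₄ : Matrix (Fin N) (Fin N) ℂ)
          + 2 • ((X₁ : Matrix (Fin N) (Fin N) ℂ) * (X₂ : Matrix (Fin N) (Fin N) ℂ) - (X₁ : Matrix (Fin N) (Fin N) ℂ) * (X₃ : Matrix (Fin N) (Fin N) ℂ)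
            - (X₁ : Matrix (Fin N) (Fin N) ℂ) * (X₄ : Matrix (Fin N) (Fin N) ℂ) - (X₂ : Matrix (Fin N) (Fin N) ℂ) * (X₃ : Matrix (Fin N) (Fin N) ℂ)
            - (X₂ : Matrix (Fin N) (Fin N) ℂ) * (X₄ : Matrix (Fin N) (Fin N) ℂ) + (X₃ : Matrix (Fin N) (Fin N) ℂ) * (X₄ : Matrix (Fin N) (Fin N) ℂ))))
  unfold UnitaryModel.nReTr at htr
  rw [Matrix.trace_sub, Complex.sub_re, sub_div, hF] at htr
  have h3 := (abs_le.mp (htr.trans hdev)).2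
  simp only [neg_div] at h3 ⊢
  linarith

end Plaquette

end Literature.MathematicalPhysics.QuantumFieldTheory.Balaban1983to89.Node00

end
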